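import Literature.Analysis.FluidPDE.TaoCascadeZeroScale
import Mathlib.Analysis.Calculus.Deriv.Inv
import Mathlib.Analysis.SpecialFunctions.ExpDeriv
import HarnessLib

/-!
# Tao's cascade ODE, §6.7 "dynamics at the zero scale", III: the energy drain `a₀, d₀ → a₁`

T. Tao, *Finite time blowup for an averaged three-dimensional Navier–Stokes equation*,
J. Amer. Math. Soc. **29** (2016), 601–674 = arXiv:1402.0290v3, §6.7 (equation numbers of arXiv v3),
the paragraph "Now we use equipartition of energy to establish some energy drain from `a₀, d₀` to
`a₁`" ((6.182)–(6.186)): with the modified energy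
`E_* := ½(a₀²+d₀²) + ½ κ a₀ d₀ (ε²/c₀) a₁` (`κ = (1+ε₀)^{5/2}K`) one has, by three exact
cancellations in the five-mode system (6.129)–(6.133) and the product rule,
`∂ₜE_* = -κ a₁ E_* + O(K^{-14}(a₀²+d₀²)^{1/2}) + O(K^{-99})` on the interval where
`c₀ ≥ K^{100} ε²`, hence "`∂ₜ(E_* + K^{-28})^{1/2} = -½ κ a₁ (E_* + K^{-28})^{1/2} + O(K^{-14})`"
and, once `a₁ ≥ 0.05`, the decay (6.186)/(6.174) `Ẽ₀(τ₁) ≲ K^{-28}`.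

This file proves these steps as stand-alone real-variable statements with free parameters and
explicit constants (conventions of `TaoCascadeZeroScale.lean`):

* `sqrt_decay_of_deriv_right_le`: if `W ≥ 0` and `W' ≤ -2βW + 2α√W + 2θ` (`β, θ > 0`, `α ≥ 0`)
  then `√W(t) ≤ e^{-β(t-a)} √W(a) + α/β + 3√(θ/β)` (the "square root in a weak sense" device of
  (6.185), via `√(W+ι)` with `ι = θ/β`);
* `modifiedEnergy_hasDerivWithinAt` / `modifiedEnergy_deriv_le`: the derivative of `E_*` and the
  bound `E_*' ≤ -κ a₁ E_* + (η₁+η₂)√(a₀²+d₀²) + Θ` with `Θ` explicit in the sup bound `M`, the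
  weight bound `w₁ ≥ 1/(ρ c₀)` and its logarithmic rate `L` ((6.182)–(6.184));
* `sqrt_modifiedEnergy_le`: the resulting decay of `(E_* + ν₀)^{1/2}` when `a₁ ≥ α₁ > 0`
  ((6.185)–(6.186)).

## References

* T. Tao, J. Amer. Math. Soc. 29 (2016), 601–674, arXiv:1402.0290v3, §6.7 (6.179)–(6.186), (6.174).
  [`Tao2016AveragedNS`]
-/

noncomputable section

open Set MeasureTheory intervalIntegral Filter Topology

namespace Literature.Analysis.FluidPDE

namespace TaoCascade

open Literature.Analysis.ODE

/-! ## Square roots of decaying supersolutions -/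

/-- `∫_a^t e^{β(s-a)} ds = (e^{β(t-a)} - 1)/β` for `β ≠ 0`. [folklore] -/
theorem integral_exp_mul_sub {a t β : ℝ} (hβ : β ≠ 0) :
    ∫ s in a..t, Real.exp (β * (s - a)) = (Real.exp (β * (t - a)) - 1) / β := by
  have hderiv : ∀ s ∈ uIcc a t,
      HasDerivAt (fun s => Real.exp (β * (s - a)) / β) (Real.exp (β * (s - a))) s := by
    intro s _
    have h1 : HasDerivAt (fun s => β * (s - a)) β s := by
      simpa using ((hasDerivAt_id s).sub_const a).const_mul β
    exact (h1.exp.div_const β).congr_deriv (mul_div_cancel_right₀ _ hβ)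
  rw [integral_eq_sub_of_hasDerivAt hderiv
    ((by fun_prop : Continuous fun s => Real.exp (β * (s - a))).intervalIntegrable a t)]
  simp [sub_div]

/-- **Square root of a decaying supersolution, with a free regularisation `ι > 0`.** If `W ≥ 0` is
continuous on `[a, b]` with right derivative `W'`, `β > 0`, `α, θ ≥ 0`, and
`W' ≤ -2βW + 2α√W + 2θ` on `[a, b)`, then for every `ι > 0` and `t ∈ [a, b]`,
`√W(t) ≤ e^{-β(t-a)}(√W(a) + √ι) + α/β + (βι + θ)/(β√ι)`. [folklore] -/
theorem sqrt_decay_core {a b : ℝ} {W W' : ℝ → ℝ} {α β θ ι : ℝ}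
    (hW : ContinuousOn W (Icc a b)) (hW' : ∀ t ∈ Ico a b, HasDerivWithinAt W (W' t) (Ici t) t)
    (hW0 : ∀ t ∈ Icc a b, 0 ≤ W t) (hβ : 0 < β) (hα : 0 ≤ α) (hθ : 0 ≤ θ) (hι : 0 < ι)
    (bound : ∀ t ∈ Ico a b, W' t ≤ -2 * β * W t + 2 * α * Real.sqrt (W t) + 2 * θ) {t : ℝ}
    (ht : t ∈ Icc a b) :
    Real.sqrt (W t) ≤ Real.exp (-β * (t - a)) * (Real.sqrt (W a) + Real.sqrt ι) +
      α / β + (β * ι + θ) / (β * Real.sqrt ι) := by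
  set h : ℝ → ℝ := fun s => Real.sqrt (W s + ι) with hh
  have hpos : ∀ s ∈ Icc a b, 0 < W s + ι := fun s hs => by linarith [hW0 s hs]
  have hhc : ContinuousOn h (Icc a b) := (hW.add continuousOn_const).sqrt
  have hsqι : 0 < Real.sqrt ι := Real.sqrt_pos.2 hι
  have hh' : ∀ s ∈ Ico a b,
      HasDerivWithinAt h (W' s / (2 * Real.sqrt (W s + ι))) (Ici s) s := by
    intro s hs
    have := ((hW' s hs).add_const ι).sqrt (hpos s (Ico_subset_Icc_self hs)).ne'
    simpa using this
  set α' : ℝ := α + (β * ι + θ) / Real.sqrt ι with hα'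
  -- `h' ≤ α' + (-β) h`
  have hbound : ∀ s ∈ Ico a b, W' s / (2 * Real.sqrt (W s + ι)) ≤ α' + (-β) * h s := by
    intro s hs
    have hs' := Ico_subset_Icc_self hs
    have hhs : 0 < Real.sqrt (W s + ι) := Real.sqrt_pos.2 (hpos s hs')
    have hhι : Real.sqrt ι ≤ Real.sqrt (W s + ι) := Real.sqrt_le_sqrt (by linarith [hW0 s hs'])
    have hWle : Real.sqrt (W s) ≤ Real.sqrt (W s + ι) := Real.sqrt_le_sqrt (by linarith)
    have hsq : Real.sqrt (W s + ι) ^ 2 = W s + ι := Real.sq_sqrt (hpos s hs').le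
    rw [div_le_iff₀ (by positivity)]
    have h1 := bound s hs
    -- `(βι + θ)/√ι · √(W+ι) ≥ βι + θ`
    have h3 : β * ι + θ ≤ (β * ι + θ) / Real.sqrt ι * Real.sqrt (W s + ι) := by
      rw [div_mul_eq_mul_div, le_div_iff₀ hsqι]
      exact mul_le_mul_of_nonneg_left hhι (by positivity)
    have h2 : 2 * α * Real.sqrt (W s) ≤ 2 * α * Real.sqrt (W s + ι) :=
      mul_le_mul_of_nonneg_left hWle (by positivity)
    show W' s ≤ (α' + (-β) * Real.sqrt (W s + ι)) * (2 * Real.sqrt (W s + ι))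
    simp only [hα']
    nlinarith
  have hcomp := le_linearComparison hhc hh' continuousOn_const continuousOn_const
    (A := fun _ => α') (β := fun _ => -β) hbound ht
  -- evaluate the comparison function
  have hB : ∀ s, ∫ u in a..s, (fun _ : ℝ => -β) u = -β * (s - a) := by
    intro s; simp only [intervalIntegral.integral_const, smul_eq_mul]; ring
  simp only [hB] at hcomp
  have hint : ∫ s in a..t, α' * Real.exp (-(-β * (s - a))) = α' * ((Real.exp (β * (t - a)) - 1) / β) := by
    rw [intervalIntegral.integral_const_mul]
    congr 1
    rw [← integral_exp_mul_sub hβ.ne']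
    congr 1; ext s; ring_nf
  rw [hint] at hcomp
  have hα'0 : 0 ≤ α' := by positivity
  have hE : Real.exp (-β * (t - a)) * Real.exp (β * (t - a)) = 1 := by
    rw [← Real.exp_add]; simp
  have hEle : Real.exp (-β * (t - a)) ≤ 1 := by
    rw [Real.exp_le_one_iff]; nlinarith [ht.1]
  have hha : h a ≤ Real.sqrt (W a) + Real.sqrt ι :=
    sqrt_add_le_sqrt_add_sqrt (hW0 a ⟨le_rfl, ht.1.trans ht.2⟩) hι.le
  calc Real.sqrt (W t) ≤ h t := Real.sqrt_le_sqrt (by linarith)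
    _ ≤ Real.exp (-β * (t - a)) * (h a + α' * ((Real.exp (β * (t - a)) - 1) / β)) := hcomp
    _ = Real.exp (-β * (t - a)) * h a +
          α' / β * (Real.exp (-β * (t - a)) * Real.exp (β * (t - a)) - Real.exp (-β * (t - a))) := by
        field_simp
    _ = Real.exp (-β * (t - a)) * h a + α' / β * (1 - Real.exp (-β * (t - a))) := by rw [hE]
    _ ≤ Real.exp (-β * (t - a)) * (Real.sqrt (W a) + Real.sqrt ι) + α' / β * 1 := by
        gcongr
        · linarith [Real.exp_pos (-β * (t - a))]
    _ = Real.exp (-β * (t - a)) * (Real.sqrt (W a) + Real.sqrt ι) +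
          α / β + (β * ι + θ) / (β * Real.sqrt ι) := by
        simp only [hα']; field_simp; ring

/-- **Square root of a decaying supersolution** ((6.185): "`∂ₜ(E_* + K^{-28})^{1/2} =
-½Ka₁(E_* + K^{-28})^{1/2} + O(K^{-14})` … conclude from Gronwall's inequality"). If `W ≥ 0` is
continuous on `[a, b]` with right derivative `W'`, `β, θ > 0`, `α ≥ 0` and
`W' ≤ -2βW + 2α√W + 2θ` on `[a, b)`, then `√W(t) ≤ e^{-β(t-a)} √W(a) + α/β + 3√(θ/β)` for
`t ∈ [a, b]`. [cite: Tao2016AveragedNS, §6.7 (6.185)–(6.186)] -/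
theorem sqrt_decay_of_deriv_right_le {a b : ℝ} {W W' : ℝ → ℝ} {α β θ : ℝ}
    (hW : ContinuousOn W (Icc a b)) (hW' : ∀ t ∈ Ico a b, HasDerivWithinAt W (W' t) (Ici t) t)
    (hW0 : ∀ t ∈ Icc a b, 0 ≤ W t) (hβ : 0 < β) (hα : 0 ≤ α) (hθ : 0 < θ)
    (bound : ∀ t ∈ Ico a b, W' t ≤ -2 * β * W t + 2 * α * Real.sqrt (W t) + 2 * θ) {t : ℝ}
    (ht : t ∈ Icc a b) :
    Real.sqrt (W t) ≤ Real.exp (-β * (t - a)) * Real.sqrt (W a) + α / β + 3 * Real.sqrt (θ / β) := by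
  have hι : 0 < θ / β := div_pos hθ hβ
  have h := sqrt_decay_core hW hW' hW0 hβ hα hθ.le hι bound ht
  have hsq : Real.sqrt (θ / β) ^ 2 = θ / β := Real.sq_sqrt hι.le
  have hsqpos : 0 < Real.sqrt (θ / β) := Real.sqrt_pos.2 hι
  -- `(β ι + θ)/(β √ι) = 2 √(θ/β)` for `ι = θ/β`
  have hid : (β * (θ / β) + θ) / (β * Real.sqrt (θ / β)) = 2 * Real.sqrt (θ / β) := by
    rw [div_eq_iff (by positivity)]
    have : β * (θ / β) = θ := by field_simp
    rw [this]
    nlinarith [hsq]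
  rw [hid] at h
  have hEle : Real.exp (-β * (t - a)) ≤ 1 := by
    rw [Real.exp_le_one_iff]; nlinarith [ht.1]
  calc Real.sqrt (W t)
      ≤ Real.exp (-β * (t - a)) * (Real.sqrt (W a) + Real.sqrt (θ / β)) + α / β +
          2 * Real.sqrt (θ / β) := h
    _ = Real.exp (-β * (t - a)) * Real.sqrt (W a) + α / β +
          (Real.exp (-β * (t - a)) * Real.sqrt (θ / β) + 2 * Real.sqrt (θ / β)) := by ring
    _ ≤ Real.exp (-β * (t - a)) * Real.sqrt (W a) + α / β +
          (1 * Real.sqrt (θ / β) + 2 * Real.sqrt (θ / β)) := by gcongr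
    _ = _ := by ring

/-! ## The modified energy of the drain -/

section Drain

variable {τ₀ : ℝ} {a₀ d₀ c₀ a₁ : ℝ → ℝ} {ρ κ : ℝ}

/-- **The derivative of the modified energy `E_* = ½(a₀²+d₀²) - ½κ a₀d₀a₁/(ρc₀)`** on an interval
where `c₀ > 0`: the product and quotient rules applied to the one-sided derivatives
`x' = derivWithin x (Ici τ₀)`. (The source writes `E_*` with `+`; with the rotation signs of
(6.129), (6.132) as printed, (6.183) `∂ₜ(a₀d₀) = ε⁻²c₀(a₀²-d₀²) + O(K)` forces the sign `-` for
the cancellation `-κd₀²a₁ - ½κ(a₀²-d₀²)a₁ = -½κ(a₀²+d₀²)a₁` behind (6.184)–(6.185), as in the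
modified energy `E*` of Prop. 6.17.) [cite: Tao2016AveragedNS, §6.7 (6.182)–(6.184)] -/
theorem modifiedEnergy_hasDerivWithinAt (ha₀ : ContDiffOn ℝ 1 a₀ (Ici τ₀))
    (hd₀ : ContDiffOn ℝ 1 d₀ (Ici τ₀)) (hc₀ : ContDiffOn ℝ 1 c₀ (Ici τ₀))
    (ha₁ : ContDiffOn ℝ 1 a₁ (Ici τ₀)) {s : ℝ} (hs : τ₀ ≤ s) (hρc : ρ * c₀ s ≠ 0) :
    HasDerivWithinAt
      (fun u => (1 / 2) * (a₀ u ^ 2 + d₀ u ^ 2) - (1 / 2) * κ * (a₀ u * d₀ u * a₁ u / (ρ * c₀ u)))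
      ((a₀ s * derivWithin a₀ (Ici τ₀) s + d₀ s * derivWithin d₀ (Ici τ₀) s) -
        (1 / 2) * κ *
          ((((derivWithin a₀ (Ici τ₀) s * d₀ s + a₀ s * derivWithin d₀ (Ici τ₀) s) * a₁ s +
              a₀ s * d₀ s * derivWithin a₁ (Ici τ₀) s) * (ρ * c₀ s) -
            a₀ s * d₀ s * a₁ s * (ρ * derivWithin c₀ (Ici τ₀) s)) / (ρ * c₀ s) ^ 2))
      (Ici s) s := by
  have h0 := hasDerivWithinAt_Ici_of_contDiffOn ha₀ hs
  have h3 := hasDerivWithinAt_Ici_of_contDiffOn hd₀ hs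
  have h2 := (hasDerivWithinAt_Ici_of_contDiffOn hc₀ hs).const_mul ρ
  have h4 := hasDerivWithinAt_Ici_of_contDiffOn ha₁ hs
  have hP := ((h0.fun_pow 2).fun_add (h3.fun_pow 2)).const_mul (1 / 2 : ℝ)
  have hprod := ((h0.fun_mul h3).fun_mul h4).fun_div h2 hρc
  have hQ := hprod.const_mul ((1 / 2 : ℝ) * κ)
  have := hP.fun_sub hQ
  first
  | exact this
  | exact this.congr_deriv (by push_cast; ring)

/-- **(6.182)–(6.184), the pointwise algebra: `∂ₜE_* ≤ -κ a₁ E_* + (η₁+η₂)√(a₀²+d₀²) + Θ`.**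
Real-variable form at one time: `A, Dd, B, C` are the values of `a₀, d₀, a₁, c₀`, and
`A', D', B', C'` those of their derivatives; the hypotheses are the `a₀`-equation with the improved
error (6.179) `|A' + ρ C Dd| ≤ η₁`, the `d₀`-equation (6.132) `|D' - (ρ C A - κ Dd B)| ≤ η₂`, the
`a₁`-equation (6.133) `|B' - κ Dd²| ≤ ν|B| + η₃`, the sup bound `|A|, |Dd|, |B| ≤ M`, `C > 0` with
`1/(ρ C) ≤ w₁` ((6.165)) and `|C'| ≤ L C` ((6.181)), `ρ > 0`, `κ, ν, η₃ ≥ 0`. Conclusion: the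
derivative value `D` of `modifiedEnergy_hasDerivWithinAt` satisfies
`D ≤ -κ B E_* + (η₁+η₂)√(A²+Dd²) + ½κ w₁ ((η₁+η₂)M² + M²(κM²+νM+η₃) + M³L)`.
[cite: Tao2016AveragedNS, §6.7 (6.182)–(6.184)] -/
theorem modifiedEnergy_algebra {A Dd B C A' D' B' C' ν η₁ η₂ η₃ M L w₁ : ℝ} (hρ : 0 < ρ)
    (hκ : 0 ≤ κ) (hν : 0 ≤ ν) (hη₃ : 0 ≤ η₃) (hC : 0 < C) (hw : 1 / (ρ * C) ≤ w₁)
    (hcL : |C'| ≤ L * C) (ha : |A| ≤ M) (hd : |Dd| ≤ M) (hb : |B| ≤ M)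
    (he₁ : |A' + ρ * C * Dd| ≤ η₁) (he₄ : |D' - (ρ * C * A - κ * Dd * B)| ≤ η₂)
    (he₅ : |B' - κ * Dd ^ 2| ≤ ν * |B| + η₃) :
    (A * A' + Dd * D') -
        (1 / 2) * κ * ((((A' * Dd + A * D') * B + A * Dd * B') * (ρ * C) - A * Dd * B * (ρ * C')) /
          (ρ * C) ^ 2) ≤
      -κ * B * ((1 / 2) * (A ^ 2 + Dd ^ 2) - (1 / 2) * κ * (A * Dd * B / (ρ * C))) +
        (η₁ + η₂) * Real.sqrt (A ^ 2 + Dd ^ 2) +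
        (1 / 2) * κ * w₁ * ((η₁ + η₂) * M ^ 2 + M ^ 2 * (κ * M ^ 2 + ν * M + η₃) + M ^ 3 * L) := by
  have hM0 : 0 ≤ M := (abs_nonneg _).trans ha
  have hη₁ : 0 ≤ η₁ := (abs_nonneg _).trans he₁
  have hη₂ : 0 ≤ η₂ := (abs_nonneg _).trans he₄
  have hC0 : C ≠ 0 := hC.ne'
  have hρ0 : ρ ≠ 0 := hρ.ne'
  have hρC : 0 < ρ * C := mul_pos hρ hC
  have hL0 : 0 ≤ L := nonneg_of_mul_nonneg_left ((abs_nonneg _).trans hcL) hC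
  -- error variables
  obtain ⟨e₁, rfl⟩ : ∃ e₁, A' = e₁ - ρ * C * Dd := ⟨A' + ρ * C * Dd, by ring⟩
  obtain ⟨e₄, rfl⟩ : ∃ e₄, D' = e₄ + (ρ * C * A - κ * Dd * B) :=
    ⟨D' - (ρ * C * A - κ * Dd * B), by ring⟩
  obtain ⟨e₅, rfl⟩ : ∃ e₅, B' = e₅ + κ * Dd ^ 2 := ⟨B' - κ * Dd ^ 2, by ring⟩
  have hb₁ : |e₁| ≤ η₁ := by simpa using he₁
  have hb₄ : |e₄| ≤ η₂ := by simpa using he₄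
  have hb₅ : |e₅| ≤ ν * |B| + η₃ := by simpa using he₅
  set w : ℝ := 1 / (ρ * C) with hwdef
  have hw0 : 0 < w := by rw [hwdef]; positivity
  have hws : w ≤ w₁ := hw
  -- the algebraic identity
  have key : (A * (e₁ - ρ * C * Dd) + Dd * (e₄ + (ρ * C * A - κ * Dd * B))) -
        (1 / 2) * κ * (((((e₁ - ρ * C * Dd) * Dd + A * (e₄ + (ρ * C * A - κ * Dd * B))) * B +
              A * Dd * (e₅ + κ * Dd ^ 2)) * (ρ * C) - A * Dd * B * (ρ * C')) / (ρ * C) ^ 2) =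
      -κ * B * ((1 / 2) * (A ^ 2 + Dd ^ 2) - (1 / 2) * κ * (A * Dd * B / (ρ * C))) +
        ((A * e₁ + Dd * e₄) -
          (1 / 2) * κ * ((e₁ * Dd + A * e₄) * B * w + A * Dd * (κ * Dd ^ 2 + e₅) * w -
            A * Dd * B * (C' / C) * w)) := by
    simp only [hwdef]
    field_simp
    ring
  rw [key]
  -- bound the two error groups
  have hsqrt : |A * e₁ + Dd * e₄| ≤ (η₁ + η₂) * Real.sqrt (A ^ 2 + Dd ^ 2) := by
    have haP : |A| ≤ Real.sqrt (A ^ 2 + Dd ^ 2) := by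
      rw [← Real.sqrt_sq_eq_abs]; exact Real.sqrt_le_sqrt (by nlinarith)
    have hdP : |Dd| ≤ Real.sqrt (A ^ 2 + Dd ^ 2) := by
      rw [← Real.sqrt_sq_eq_abs]; exact Real.sqrt_le_sqrt (by nlinarith)
    calc |A * e₁ + Dd * e₄| ≤ |A * e₁| + |Dd * e₄| := abs_add_le _ _
      _ = |A| * |e₁| + |Dd| * |e₄| := by rw [abs_mul, abs_mul]
      _ ≤ Real.sqrt (A ^ 2 + Dd ^ 2) * η₁ + Real.sqrt (A ^ 2 + Dd ^ 2) * η₂ :=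
          add_le_add (mul_le_mul haP hb₁ (abs_nonneg _) (Real.sqrt_nonneg _))
            (mul_le_mul hdP hb₄ (abs_nonneg _) (Real.sqrt_nonneg _))
      _ = (η₁ + η₂) * Real.sqrt (A ^ 2 + Dd ^ 2) := by ring
  have hAD : |A| * |Dd| ≤ M ^ 2 := by nlinarith [abs_nonneg A, abs_nonneg Dd]
  have t2 : |(e₁ * Dd + A * e₄) * B * w| ≤ (η₁ + η₂) * M ^ 2 * w₁ := by
    rw [abs_mul, abs_mul, abs_of_pos hw0]
    have h12 : |e₁ * Dd + A * e₄| ≤ (η₁ + η₂) * M := by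
      calc |e₁ * Dd + A * e₄| ≤ |e₁ * Dd| + |A * e₄| := abs_add_le _ _
        _ = |e₁| * |Dd| + |A| * |e₄| := by rw [abs_mul, abs_mul]
        _ ≤ η₁ * M + M * η₂ :=
            add_le_add (mul_le_mul hb₁ hd (abs_nonneg _) hη₁) (mul_le_mul ha hb₄ (abs_nonneg _) hM0)
        _ = (η₁ + η₂) * M := by ring
    have hη12 : 0 ≤ (η₁ + η₂) * M := by positivity
    calc |e₁ * Dd + A * e₄| * |B| * w ≤ (η₁ + η₂) * M * M * w₁ :=
          mul_le_mul (mul_le_mul h12 hb (abs_nonneg _) hη12) hws hw0.le (by positivity)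
      _ = (η₁ + η₂) * M ^ 2 * w₁ := by ring
  have t3 : |A * Dd * (κ * Dd ^ 2 + e₅) * w| ≤ M ^ 2 * (κ * M ^ 2 + ν * M + η₃) * w₁ := by
    rw [abs_mul, abs_mul, abs_mul, abs_of_pos hw0]
    have he₅b : |κ * Dd ^ 2 + e₅| ≤ κ * M ^ 2 + ν * M + η₃ := by
      calc |κ * Dd ^ 2 + e₅| ≤ |κ * Dd ^ 2| + |e₅| := abs_add_le _ _
        _ ≤ κ * M ^ 2 + (ν * |B| + η₃) := by
            apply add_le_add _ hb₅
            rw [abs_mul, abs_of_nonneg hκ, abs_pow]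
            exact mul_le_mul_of_nonneg_left (pow_le_pow_left₀ (abs_nonneg _) hd 2) hκ
        _ ≤ κ * M ^ 2 + (ν * M + η₃) := by gcongr
        _ = κ * M ^ 2 + ν * M + η₃ := by ring
    have h0 : 0 ≤ κ * M ^ 2 + ν * M + η₃ := by positivity
    calc |A| * |Dd| * |κ * Dd ^ 2 + e₅| * w ≤ M ^ 2 * (κ * M ^ 2 + ν * M + η₃) * w₁ :=
          mul_le_mul (mul_le_mul hAD he₅b (abs_nonneg _) (by positivity)) hws hw0.le
            (by positivity)
      _ = _ := rfl
  have t4 : |A * Dd * B * (C' / C) * w| ≤ M ^ 3 * L * w₁ := by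
    simp only [abs_mul, abs_div, abs_of_pos hw0, abs_of_pos hC]
    have hcL' : |C'| / C ≤ L := by rw [div_le_iff₀ hC]; exact hcL
    have h1 : |A| * |Dd| * |B| ≤ M ^ 2 * M := mul_le_mul hAD hb (abs_nonneg _) (by positivity)
    have h2 : |A| * |Dd| * |B| * (|C'| / C) ≤ M ^ 2 * M * L :=
      mul_le_mul h1 hcL' (by positivity) (by positivity)
    calc |A| * |Dd| * |B| * (|C'| / C) * w ≤ M ^ 2 * M * L * w₁ :=
          mul_le_mul h2 hws hw0.le (by positivity)
      _ = M ^ 3 * L * w₁ := by ring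
  have hbr : -((e₁ * Dd + A * e₄) * B * w + A * Dd * (κ * Dd ^ 2 + e₅) * w -
      A * Dd * B * (C' / C) * w) ≤
      (η₁ + η₂) * M ^ 2 * w₁ + M ^ 2 * (κ * M ^ 2 + ν * M + η₃) * w₁ + M ^ 3 * L * w₁ := by
    have u2 := neg_abs_le ((e₁ * Dd + A * e₄) * B * w)
    have u3 := neg_abs_le (A * Dd * (κ * Dd ^ 2 + e₅) * w)
    have u4 := le_abs_self (A * Dd * B * (C' / C) * w)
    linarith
  have hX := le_abs_self (A * e₁ + Dd * e₄)
  have hκ2 : 0 ≤ (1 / 2) * κ := by positivity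
  have hB := mul_le_mul_of_nonneg_left hbr hκ2
  linarith

end Drain


/-- **From (6.184) to the supersolution inequality of (6.185).** Real-variable bookkeeping: if
`W = E + ν₀ ≥ 0` (`ν₀ ≥ 0`), `P ≤ 2W`, `α₁ ≤ a ≤ M`, `κ, η ≥ 0`, and
`D ≤ -κ a E + η √P + Θ`, then `D ≤ -2(κα₁/2) W + 2(η/√2·…)`, precisely
`D ≤ -κ α₁ W + √2 η √W + (κ M ν₀ + Θ)` — the form `W' ≤ -2βW + 2α√W + 2θ` of
`sqrt_decay_of_deriv_right_le` with `β = κα₁/2`, `α = η/√2`, `θ = (κMν₀ + Θ)/2`.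
[cite: Tao2016AveragedNS, §6.7 (6.184)–(6.185)] -/
theorem drain_supersolution_algebra {W E P D a κ α₁ M η Θ ν₀ : ℝ} (hW : W = E + ν₀)
    (hW0 : 0 ≤ W) (hν₀ : 0 ≤ ν₀) (hP2 : P ≤ 2 * W) (ha : α₁ ≤ a)
    (haM : a ≤ M) (hκ : 0 ≤ κ) (hη : 0 ≤ η) (hD : D ≤ -κ * a * E + η * Real.sqrt P + Θ) :
    D ≤ -2 * (κ * α₁ / 2) * W + 2 * (η / Real.sqrt 2) * Real.sqrt W + 2 * ((κ * M * ν₀ + Θ) / 2) := by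
  have h2 : (0 : ℝ) < Real.sqrt 2 := Real.sqrt_pos.2 (by norm_num)
  have hsqrt : Real.sqrt P ≤ Real.sqrt 2 * Real.sqrt W := by
    rw [← Real.sqrt_mul (by norm_num : (0 : ℝ) ≤ 2)]
    exact Real.sqrt_le_sqrt hP2
  have hE : E = W - ν₀ := by linarith
  rw [hE] at hD
  have h1 : -κ * a * (W - ν₀) ≤ -κ * α₁ * W + κ * M * ν₀ := by
    have : -κ * a * (W - ν₀) = -(κ * a * W) + κ * a * ν₀ := by ring
    rw [this]
    have t1 : κ * α₁ * W ≤ κ * a * W := by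
      apply mul_le_mul_of_nonneg_right _ hW0
      exact mul_le_mul_of_nonneg_left ha hκ
    have t2 : κ * a * ν₀ ≤ κ * M * ν₀ := by
      apply mul_le_mul_of_nonneg_right _ hν₀
      exact mul_le_mul_of_nonneg_left haM hκ
    linarith
  have h3 : η * Real.sqrt P ≤ η * (Real.sqrt 2 * Real.sqrt W) := mul_le_mul_of_nonneg_left hsqrt hη
  have h4 : 2 * (η / Real.sqrt 2) * Real.sqrt W = η * (Real.sqrt 2 * Real.sqrt W) := by
    have hsq : Real.sqrt 2 ^ 2 = 2 := Real.sq_sqrt (by norm_num)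
    field_simp
    rw [hsq]
    ring
  rw [h4]
  linarith

end TaoCascade

end Literature.Analysis.FluidPDE
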